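import Literature.Probability.Process.BrownianModulus
import Literature.Probability.RandomPlanarGeometry.LoewnerScaling
import Literature.Probability.RandomPlanarGeometry.LoewnerTipContinuity
import Literature.Probability.RandomPlanarGeometry.SLEGridBounds
import Literature.Probability.RandomPlanarGeometry.SLETraceCriterionProofs
import HarnessLib

/-!
# Rohde–Schramm's Theorem 3.6 from Corollary 3.5; the trace theorem from the derivative estimate

Trunk T-STOCH. We **prove** the named fact `Literature.Probability.RandomPlanarGeometry.RohdeSchramm2005_thm36`
(`SLETraceCriterion.lean`; Rohde–Schramm, *Basic properties of SLE*, Ann. Math. 161 (2005),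
Thm. 3.6: for `κ > 0`, `κ ≠ 8`, almost surely `H(y, t) = f̂ₜ(iy)` extends continuously to
`[0, ∞) × [0, ∞)`) **from the one-point derivative estimate Cor. 3.5** (the named fact
`Literature.Probability.RandomPlanarGeometry.RohdeSchramm2005_cor35`, `SLEDerivativeEstimates.lean`, on the canonical space):
`RohdeSchramm2005_thm36_of_cor35`. Consequently the Rohde–Schramm trace theorem
`Literature.Probability.RandomPlanarGeometry.hasSLETrace_of_ne_eight` (Thm. 5.1) follows from Cor. 3.5 alone
(`hasSLETrace_of_ne_eight_of_cor35`; Thm. 4.1 is `RohdeSchramm2005_thm41_holds`).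

The printed proof of Thm. 3.6 (pp. 895–898) is assembled from the tree as follows.

1. *Borel–Cantelli on the dyadic grid* (`SLEGridBounds.lean`, from Cor. 3.5): almost surely
   `|f̂'_{k 4^{-j}}(i 2^{-j})| ≤ c 2^{(1-σ) j}` for all `j`, `k < 4ʲ`, with `σ = σ₀(κ)/2 > 0`
   (`σ₀ > 0` is where `κ ≠ 8` enters, `RohdeSchramm.sigma0_pos`).
2. *Oscillation of the driving function*: Lévy's modulus of continuity for Brownian motion
   (`ProbabilityTheory.IsBrownianReal.ae_forall_exists_abs_sub_le_sqrt`, `Process/BrownianModulus.lean`)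
   in place of the printed random partition `t̂ₙ` (as in Lawler, *Conformally Invariant Processes
   in the Plane* (2005), Lemma 4.33 (4.28) and proof of Thm. 7.4).
3. *Deterministic continuity lemma* (`Loewner.continuousOn_extendFrom_tipApproach`,
   `LoewnerTipContinuity.lean`; Koebe distortion, the inverse cocycle (3.23), the chaining of
   p. 898): `H` extends continuously to `[0, ∞) × [0, 1)`.
4. *Scale invariance* ("By scale invariance, it is enough to show continuity of `H` on
   `[0, ∞) × [0, 1)`", p. 895): for `c = 2ⁿ` the process `Bₙ(t) = c⁻¹ B(c² t)` is again a Brownian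
   motion with continuous paths (Mathlib `IsBrownianReal.smul`), its driving function `Wₙ = √κ Bₙ`
   satisfies `W = c Wₙ(·/c²)`, and `H_W(y, t) = c H_{Wₙ}(y/c, t/c²)` (`Loewner.tipApproach_scale`,
   from `Loewner.loewnerInv_scale`); steps 1–3 for every `Bₙ` (a countable intersection of almost
   sure events) give continuity on `[0, ∞) × [0, 4ⁿ)` for every `n`
   (`Loewner.continuous_extendFrom_tipApproach_of_scales`).

Everything is on the canonical space `(ℝ≥0 → ℝ, preWienerMeasure)` with the canonical Brownian
motion `Process.brownian` (all paths continuous); if the existence fact behind `brownian` fails,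
`brownian = 0` (its documented junk value), the driving function vanishes and
`H(y, t) = i √(y² + 4t)` extends explicitly (`Loewner.invFunOn_map_zero_driving`).

## References

* S. Rohde, O. Schramm, *Basic properties of SLE*, Ann. of Math. 161 (2005), Cor. 3.5, Thm. 3.6
  and its proof (pp. 895–898), Thm. 4.1, Thm. 5.1.
* G. F. Lawler, *Conformally Invariant Processes in the Plane*, AMS (2005), Lemma 4.33, Thm. 7.4.
-/

noncomputable section

open Set Filter Topology Metric Complex MeasureTheory ProbabilityTheory
open UpperHalfPlane (upperHalfPlaneSet isOpen_upperHalfPlaneSet)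
open scoped NNReal

namespace Literature.Probability.RandomPlanarGeometry

namespace Loewner

variable {W V : ℝ≥0 → ℝ}

/-! ### Scale invariance of `H` -/

/-- **Scaling of `H`**: for the rescaled driving function `S_c V = (s ↦ c V(s/c²))`, `c > 0`, and
`y ≠ 0`, `H_{S_c V}(y, t) = c H_V(y/c, t/c²)` (from `f^{S_c V}_t (c w) = c f^V_{t/c²}(w)`,
`loewnerInv_scale`, at `w = V(t/c²) + i y/c`). Rohde–Schramm (2005), Prop. 2.1 (i) and proof of
Thm. 3.6 ("By scale invariance"). [cite: RohdeSchramm2005, Thm 3.6 (proof, p. 895)] -/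
theorem tipApproach_scale (hV : Continuous V) {c : ℝ≥0} (hc : c ≠ 0) {y : ℝ≥0} (hy : y ≠ 0)
    (t : ℝ≥0) :
    tipApproach (fun s ↦ (c : ℝ) * V (s / c ^ 2)) (y, t) =
      ((c : ℝ) : ℂ) * tipApproach V (y / c, t / c ^ 2) := by
  have hc' : (0 : ℝ) < c := NNReal.coe_pos.2 (pos_iff_ne_zero.2 hc)
  have hy' : (0 : ℝ) < y := NNReal.coe_pos.2 (pos_iff_ne_zero.2 hy)
  have him : 0 < ((V (t / c ^ 2) : ℂ) + I * (((y / c : ℝ≥0) : ℝ) : ℂ)).im := by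
    simp only [Complex.add_im, Complex.ofReal_im, Complex.mul_im, Complex.I_re, Complex.I_im,
      Complex.ofReal_re, zero_mul, one_mul, zero_add, NNReal.coe_div]
    positivity
  change loewnerInv (fun s ↦ (c : ℝ) * V (s / c ^ 2)) t
      ((((c : ℝ) * V (t / c ^ 2) : ℝ) : ℂ) + I * ((y : ℝ) : ℂ)) =
    ((c : ℝ) : ℂ) * loewnerInv V (t / c ^ 2) ((V (t / c ^ 2) : ℂ) + I * (((y / c : ℝ≥0) : ℝ) : ℂ))
  have hpt : (((c : ℝ) * V (t / c ^ 2) : ℝ) : ℂ) + I * ((y : ℝ) : ℂ) =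
      ((c : ℝ) : ℂ) * ((V (t / c ^ 2) : ℂ) + I * (((y / c : ℝ≥0) : ℝ) : ℂ)) := by
    have hcc : ((c : ℝ) : ℂ) ≠ 0 := by exact_mod_cast hc'.ne'
    push_cast
    field_simp
  rw [hpt, loewnerInv_scale hV hc t him]

/-- **Continuity of `H` on the whole quadrant from continuity below level `1` at all scales.**
Let `W` be continuous and, for every `n`, `W = S_{2ⁿ} Vₙ` (`W s = 2ⁿ Vₙ(s/4ⁿ)`) with `Vₙ` continuous
and `extendFrom {y ≠ 0} H_{Vₙ}` continuous on `{t < 1}`. Then `extendFrom {y ≠ 0} H_W` is continuous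
on `[0, ∞) × [0, ∞)` and agrees with `H_W` off the axis: on `{t < 4ⁿ}` the function `H_W` is the
rescaling `(y, t) ↦ 2ⁿ Ĥ_{Vₙ}(y/2ⁿ, t/4ⁿ)` of a continuous function off the axis, so it has limits
within `{y ≠ 0}` everywhere there (Mathlib `continuousOn_extendFrom`). Rohde–Schramm (2005), proof
of Thm. 3.6, p. 895 ("By scale invariance, it is enough to show continuity of `H` on
`[0, ∞) × [0, 1)`"). [cite: RohdeSchramm2005, Thm 3.6 (proof, p. 895)] -/
theorem continuous_extendFrom_tipApproach_of_scales (hW : Continuous W) (V : ℕ → ℝ≥0 → ℝ)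
    (hV : ∀ n, Continuous (V n))
    (hWV : ∀ n (s : ℝ≥0), W s = ((2 ^ n : ℝ≥0) : ℝ) * V n (s / (2 ^ n) ^ 2))
    (hcont : ∀ n, ContinuousOn (extendFrom {p | p.1 ≠ 0} (tipApproach (V n))) {p | p.2 < 1}) :
    Continuous (extendFrom {p | p.1 ≠ 0} (tipApproach W)) ∧
      ∀ p : ℝ≥0 × ℝ≥0, p.1 ≠ 0 → extendFrom {p | p.1 ≠ 0} (tipApproach W) p = tipApproach W p := by
  set A : Set (ℝ≥0 × ℝ≥0) := {p | p.1 ≠ 0} with hA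
  have hWA : ContinuousOn (tipApproach W) A := fun p hp ↦ (continuousAt_tipApproach hW hp).continuousWithinAt
  refine ⟨continuous_iff_continuousAt.2 fun x ↦ ?_, extendFrom_extends hWA⟩
  -- a scale `c = 2ⁿ` with `x.2 < c²`
  obtain ⟨n, hn⟩ : ∃ n : ℕ, x.2 < ((2 : ℝ≥0) ^ n) ^ 2 := by
    obtain ⟨n, hn⟩ := pow_unbounded_of_one_lt x.2 (by norm_num : (1 : ℝ≥0) < 4)
    refine ⟨n, ?_⟩
    rwa [← pow_mul, mul_comm, pow_mul, show (2 : ℝ≥0) ^ 2 = 4 by norm_num]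
  set c : ℝ≥0 := 2 ^ n with hc
  have hc0 : c ≠ 0 := pow_ne_zero n two_ne_zero
  set U : Set (ℝ≥0 × ℝ≥0) := {p | p.2 < c ^ 2} with hU
  have hUo : IsOpen U := isOpen_lt continuous_snd continuous_const
  have hxU : x ∈ U := hn
  -- the rescaled continuous function
  set φ : ℝ≥0 × ℝ≥0 → ℝ≥0 × ℝ≥0 := fun p ↦ (p.1 / c, p.2 / c ^ 2) with hφ
  have hφc : Continuous φ := (continuous_fst.div_const _).prodMk (continuous_snd.div_const _)
  set G : ℝ≥0 × ℝ≥0 → ℂ := fun p ↦ ((c : ℝ) : ℂ) * extendFrom A (tipApproach (V n)) (φ p) with hG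
  have hWfun : W = fun s ↦ (c : ℝ) * V n (s / c ^ 2) := funext fun s ↦ by rw [hWV n s]
  have hVA : ContinuousOn (tipApproach (V n)) A :=
    fun p hp ↦ (continuousAt_tipApproach (hV n) hp).continuousWithinAt
  -- `H_W = G` on `A ∩ U`
  have hGeq : ∀ p ∈ A ∩ U, tipApproach W p = G p := by
    rintro ⟨y, t⟩ ⟨hpA, -⟩
    have hy : y ≠ 0 := hpA
    have hφA : φ (y, t) ∈ A := by
      change y / c ≠ 0
      exact div_ne_zero hy hc0
    rw [hG]
    simp only
    rw [extendFrom_extends hVA _ hφA, hWfun, tipApproach_scale (hV n) hc0 hy t]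
  -- `G` is continuous at every point of `U`
  have hGc : ∀ p ∈ U, ContinuousAt G p := by
    intro p hpU
    have h1 : ContinuousAt (extendFrom A (tipApproach (V n))) (φ p) := by
      refine (hcont n).continuousAt (IsOpen.mem_nhds (isOpen_lt continuous_snd continuous_const) ?_)
      change p.2 / c ^ 2 < 1
      rw [div_lt_one (pos_iff_ne_zero.2 (pow_ne_zero 2 hc0))]
      exact hpU
    exact (continuousAt_const.mul (h1.comp hφc.continuousAt))
  -- hence `H_W` has limits within `A` at every point of `U`
  have hlim : ∀ p ∈ U, ∃ l, Tendsto (tipApproach W) (𝓝[A] p) (𝓝 l) := by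
    intro p hpU
    refine ⟨G p, ?_⟩
    have hev : tipApproach W =ᶠ[𝓝[A] p] G := by
      have hmem : A ∩ U ∈ 𝓝[A] p := inter_mem_nhdsWithin A (hUo.mem_nhds hpU)
      filter_upwards [hmem] with q hq using hGeq q hq
    exact ((hGc p hpU).tendsto.mono_left nhdsWithin_le_nhds).congr' hev.symm
  have hcU : ContinuousOn (extendFrom A (tipApproach W)) U := by
    refine continuousOn_extendFrom (fun p _ ↦ ?_) hlim
    rw [RohdeSchramm.dense_setOf_fst_ne_zero.closure_eq]
    exact mem_univ _
  exact hcU.continuousAt (hUo.mem_nhds hxU)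

end Loewner

/-! ### Theorem 3.6 from Corollary 3.5 -/

/-- **Rohde–Schramm (2005), Thm. 3.6, from Cor. 3.5.** On the canonical space, the derivative
estimate `RohdeSchramm2005_cor35` implies `RohdeSchramm2005_thm36`: for `κ > 0`, `κ ≠ 8`, almost
surely `H(y, t) = f̂ₜ(iy)` extends continuously to `[0, ∞) × [0, ∞)` (the extension being
`extendFrom {y ≠ 0} H`). Proof as printed (pp. 895–898) in Lawler's arrangement: Borel–Cantelli on
the dyadic grid (`RohdeSchramm2005_cor35.ae_exists_grid`), Lévy's modulus for the driving function
(`IsBrownianReal.ae_forall_exists_abs_sub_le_sqrt`), the deterministic Lemma 4.33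
(`Loewner.continuousOn_extendFrom_tipApproach`) for each rescaled Brownian motion
`Bₙ = 2^{-n} B(4ⁿ ·)` (Mathlib `IsBrownianReal.smul`), and scale invariance
(`Loewner.continuous_extendFrom_tipApproach_of_scales`). [cite: RohdeSchramm2005, Thm 3.6] -/
theorem RohdeSchramm2005_thm36_of_cor35 (h : RohdeSchramm2005_cor35 Process.preWienerMeasure) :
    RohdeSchramm2005_thm36 := by
  intro κ hκ h8
  by_cases hex : Process.exists_isBrownianReal_measurable_continuous
  · -- the canonical Brownian motion is a Brownian motion
    have hB : IsBrownianReal Process.brownian Process.preWienerMeasure :=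
      Process.isBrownianReal_brownian hex
    have hκpos : (0 : ℝ) < κ := by exact_mod_cast pos_iff_ne_zero.2 hκ
    set σ : ℝ := RohdeSchramm.sigma0 κ / 2 with hσ
    have hσpos : 0 < RohdeSchramm.sigma0 κ := RohdeSchramm.sigma0_pos hκpos (by exact_mod_cast h8)
    have hσ0 : 0 < σ := by positivity
    have hσ1 : σ < RohdeSchramm.sigma0 κ := by rw [hσ]; linarith
    -- the rescaled Brownian motions `Bₙ(t) = 2^{-n} B(4ⁿ t)` and their driving functions
    set Bs : ℕ → ℝ≥0 → (ℝ≥0 → ℝ) → ℝ := fun n t ω ↦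
      (√((((2 : ℝ≥0) ^ n) ^ 2 : ℝ≥0) : ℝ))⁻¹ * Process.brownian (((2 : ℝ≥0) ^ n) ^ 2 * t) ω with hBs
    have hBn : ∀ n, IsBrownianReal (Bs n) Process.preWienerMeasure := fun n ↦
      hB.smul (pow_ne_zero 2 (pow_ne_zero n two_ne_zero))
    have hBc : ∀ n ω, Continuous fun t ↦ Bs n t ω := fun n ω ↦
      continuous_const.mul ((Process.continuous_brownian ω).comp (continuous_const.mul continuous_id))
    have hsq : ∀ n : ℕ, √((((2 : ℝ≥0) ^ n) ^ 2 : ℝ≥0) : ℝ) = ((2 ^ n : ℝ≥0) : ℝ) := fun n ↦ by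
      push_cast
      exact Real.sqrt_sq (by positivity)
    -- almost surely: grid bounds and modulus at every scale
    have hgrid : ∀ n, ∀ᵐ ω ∂Process.preWienerMeasure, ∃ c : ℝ, ∀ j k : ℕ, k < 4 ^ j →
        ‖deriv (Loewner.fHat (fun s ↦ Real.sqrt κ * Bs n s ω) ((k : ℝ≥0) / 4 ^ j))
          (I * ((2 : ℝ) ^ (-(j : ℝ)) : ℝ))‖ ≤ c * (2 : ℝ) ^ ((1 - σ) * j) :=
      fun n ↦ h.ae_exists_grid hκ h8 hσ0 hσ1 (hBn n) (hBc n)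
    have hmod : ∀ n, ∀ᵐ ω ∂Process.preWienerMeasure, ∃ c : ℝ, ∀ j : ℕ, 1 ≤ j → ∀ s t : ℝ≥0,
        s ≤ (2 : ℕ) → t ≤ (2 : ℕ) → dist s t ≤ (4 ^ j)⁻¹ →
        |Bs n s ω - Bs n t ω| ≤ c * Real.sqrt j / 2 ^ j := fun n ↦ by
      filter_upwards [(hBn n).ae_forall_exists_abs_sub_le_sqrt] with ω hω using hω 2
    rw [← ae_all_iff] at hgrid hmod
    filter_upwards [hgrid, hmod] with ω hg hm
    -- deterministic part, for the fixed path `ω`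
    have hW : Continuous (sleDriving κ ω) := continuous_sleDriving κ ω
    set V : ℕ → ℝ≥0 → ℝ := fun n s ↦ Real.sqrt κ * Bs n s ω with hV
    have hVc : ∀ n, Continuous (V n) := fun n ↦ continuous_const.mul (hBc n ω)
    have hWV : ∀ n (s : ℝ≥0), sleDriving κ ω s = ((2 ^ n : ℝ≥0) : ℝ) * V n (s / (2 ^ n) ^ 2) := by
      intro n s
      have hc : ((2 : ℝ≥0) ^ n) ^ 2 ≠ 0 := pow_ne_zero 2 (pow_ne_zero n two_ne_zero)
      rw [sleDriving_apply, hV, hBs]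
      simp only
      rw [hsq n, mul_div_cancel₀ _ hc]
      have h2 : ((2 ^ n : ℝ≥0) : ℝ) ≠ 0 := by positivity
      field_simp
    obtain ⟨hc, heq⟩ := Loewner.continuous_extendFrom_tipApproach_of_scales hW V hVc hWV fun n ↦ by
      obtain ⟨c₁, hc₁⟩ := hg n
      obtain ⟨c₂, hc₂⟩ := hm n
      refine Loewner.continuousOn_extendFrom_tipApproach (hVc n) hσ0 hc₁ (c₂ := Real.sqrt κ * c₂) ?_
      intro j hj s t hs ht hd
      have h1 := hc₂ j hj s t (by simpa using hs) (by simpa using ht) hd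
      rw [hV]
      simp only
      rw [← mul_sub, abs_mul, abs_of_nonneg (Real.sqrt_nonneg _), mul_assoc, mul_div_assoc]
      exact mul_le_mul_of_nonneg_left h1 (Real.sqrt_nonneg _)
    exact ⟨_, hc, fun y t hy ↦ by rw [heq (y, t) hy]; rfl⟩
  · -- junk case: no Brownian motion, `brownian = 0`, driving function `0`
    have hb : Process.brownian = 0 := by
      unfold Process.exists_isBrownianReal_measurable_continuous at hex
      unfold Process.brownian
      rw [dif_neg hex]
    refine ae_of_all _ fun ω ↦ ?_
    have hW0 : sleDriving κ ω = fun _ ↦ (0 : ℝ) := by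
      funext t
      simp [sleDriving_apply, hb]
    refine ⟨fun p ↦ I * (Real.sqrt ((p.1 : ℝ) ^ 2 + 4 * (p.2 : ℝ)) : ℂ), ?_, fun y t hy ↦ ?_⟩
    · exact continuous_const.mul (Complex.continuous_ofReal.comp (Real.continuous_sqrt.comp
        (((NNReal.continuous_coe.comp continuous_fst).pow 2).add
          (continuous_const.mul (NNReal.continuous_coe.comp continuous_snd)))))
    · rw [hW0]
      simp only [Complex.ofReal_zero, zero_add]
      exact (Loewner.invFunOn_map_zero_driving t (NNReal.coe_pos.2 (pos_iff_ne_zero.2 hy))).symm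

/-- **The Rohde–Schramm trace theorem from Cor. 3.5**: the named fact `hasSLETrace_of_ne_eight`
(Rohde–Schramm (2005), Thm. 5.1: SLE_κ is generated by a curve for `κ ≠ 8`) follows from the
one-point derivative estimate `RohdeSchramm2005_cor35` on the canonical space alone — Thm. 3.6 by
`RohdeSchramm2005_thm36_of_cor35`, Thm. 4.1 by `RohdeSchramm2005_thm41_holds`, the case `κ = 0`
by `hasSLETrace_zero` (`hasSLETrace_of_ne_eight_of_thm36`). [cite: RohdeSchramm2005, Thm 5.1] -/
theorem hasSLETrace_of_ne_eight_of_cor35 (h : RohdeSchramm2005_cor35 Process.preWienerMeasure) :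
    hasSLETrace_of_ne_eight :=
  hasSLETrace_of_ne_eight_of_thm36 (RohdeSchramm2005_thm36_of_cor35 h)

/-- **`exists_isSLECurve` from three one-dimensional stochastic inputs**: Lawler–Schramm–Werner's
`κ = 8` trace theorem (`hasSLETrace_eight`), Rohde–Schramm's derivative estimate Cor. 3.5
(`RohdeSchramm2005_cor35`) and transience Thm. 7.1 (`tendsto_norm_sleTrace_atTop`)
(`exists_isSLECurve_of_thm36`). [cite: RohdeSchramm2005, Thm 5.1] -/
theorem exists_isSLECurve_of_cor35 (h8 : hasSLETrace_eight)
    (h : RohdeSchramm2005_cor35 Process.preWienerMeasure) (htr : tendsto_norm_sleTrace_atTop) :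
    exists_isSLECurve :=
  exists_isSLECurve_of_thm36 h8 (RohdeSchramm2005_thm36_of_cor35 h) htr

end Literature.Probability.RandomPlanarGeometry
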